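import Summits.BirchSwinnertonDyer.BirchSwinnertonDyer.Theorems.PrintCf2RamifiedOffTYZLowerHalfRhoOneOfFacts
import Literature.NumberTheory.EllipticCurves.TianYuanZhang2017.RhoIndexTorsionClasses
import Literature.NumberTheory.EllipticCurves.TianYuanZhang2017.GenusDescentEnSide
import Literature.NumberTheory.EllipticCurves.CongruentNumberCurveTorsionProofs
import HarnessLib

/-!
# Crux `PrintCf2.RamifiedOffTYZOfFacts` (stmt-BirchSwinnertonDyer-20509), line `offtyz-v7`, LEAD cycle 16 (cruxlead-20509 g15):
# THE LOWER HALF OF C⁺ ON THE ODD CLASS AS A `ρ`-DICHOTOMY — «`ρ(n) ≠ 0` ⟹ `2 ∣ 𝓛(n)`» from the named facts, generator-free,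
# and the reduction of the whole odd lower half to the SPECIAL STRATUM `ρ(n) = 0`

THEOREMS ONLY (no `def`, no named fact, no `sorry`), `--supports stmt-BirchSwinnertonDyer-20509` (helper toward C⁺ = item 23431
`RamifiedJumpOneLevelTwoOfFacts`).  g11's `LowerHalfRhoOne.two_dvd_scriptL_rhoOne_odd_of_facts` (p729409; aside 23304 ✓) carries the
stratum `ρ(n) = 1` as «a generator `R = (x, y)` of `E_n(ℚ)/tors` with `x ∉ {1, −1, n, −n}·ℚ^{×2}`».  This file removes the generator from the
statement: the hypothesis becomes the printed index itself, `(rhoSubgroup n).index ≠ 1` (`2^{ρ(n)} = [E_n(ℚ) : φ_n(A_n(ℚ)) + E_n[2]]`,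
[TYZ 2017, §1]), via

* §1 `mem_rhoSubgroup_of_x_special` — a rational point whose abscissa lies in `{1, −1, n, −n}·ℚ^{×2}` lies in `φ_n(A_n(ℚ)) + E_n[2]`
  (translate by the `2`-torsion point of the same class; Silverman X.4.9); `rhoIndex_eq_one_of_generator_special` — if a generator modulo
  torsion is special then `ρ(n) = 0` (every torsion point of `E_n(ℚ)` is killed by `2`, tree theorem
  `two_nsmul_eq_zero_of_isOfFinAddOrder_congruentNumberCurve`); `exists_generator_not_special_of_rhoIndex_ne_one` — for rank `≤ 1` (Mordell–Weil
  basis, `W2.stub_S0`) and `ρ(n) ≠ 0` there is a NON-special generator.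
* §2 `two_dvd_scriptL_odd_of_rhoIndex_ne_one_of_facts` — **granted `tyz_cmPointRingClassFrobeniusData ∧ thm11_parity_of_scriptL ∧ GZK`: for every
  square-free odd `n ≡ 5, 7 (mod 8)` with `ord_{s=1} L(E_n, s) = 1`, `#Sel₂(E_n/ℚ) = 2^{2+s}` (`s ≥ 2`) and `ρ(n) ≠ 0`, every integer `L` with
  `𝓛(n)² = L²` is EVEN.**
* §3 `two_dvd_scriptL_odd_of_rhoZero_statement` — the odd lower half of C⁺ on the whole `s ≥ 2` class FOLLOWS from the same statement on the special
  stratum `ρ(n) = 0` alone (pure logic with §2): the special stratum is the EXACT residual of the lower half.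
* §4 (appended) `rhoIndex_ne_one_of_point`, `two_dvd_scriptL_odd_of_point_of_facts` — the lower half from ONE rational point with non-special abscissa
  (no generator / Mordell–Weil basis in the hypotheses).

WHY (census of this cycle, crux workfile `Lines/offtyz_v7_SpecialStratum.md`, kit-free 2-descent on `A_n` + Cassels): on the odd two-prime jump-one
class the special stratum `ρ(n) = 0` is 574/1434 = 40 % of the members `n ≤ 10⁵` (laws: `ρ = 1 ⟺ (l/m)₄(m/l)₄ = −1` on R1, `⟺ 8 ∤ h(−4l)` on R2,
0 exceptions) — not a corner; on it the half `Q₁` is frozen (`…GenusCharacterRho`, p726885) and no Galois-motion door applies.  BSD is not proved by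
any of this; no route item is closed by this file.

References: [cite: TianYuanZhang2017, §1 (ρ(n), p0002 L101–L110), Thm. 1.1, §3]; [cite: SilvermanAEC2009, Prop. X.4.9, Thm. X.1.1];
[cite: Knapp1993, Thm. 5.2 (torsion of E_n)]; [cite: HeathBrown1994SelmerCongruentII, Appendix (Monsky)]; [cite: Darmon2004, Thm. 3.22].
-/

noncomputable section

open scoped Classical

open WeierstrassCurve WeierstrassCurve.Affine WeierstrassCurve.Affine.Point
  Literature.NumberTheory.EllipticCurves Literature.NumberTheory.EllipticCurves.TianYuanZhang2017
  Literature.NumberTheory.EllipticCurves.TianYuanZhang2017.RhoMonskyKernel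
  Literature.NumberTheory.EllipticCurves.TwoDescentLocal

set_option autoImplicit false

namespace Summit.BirchSwinnertonDyer.PrintCf2.SpecialStratum

variable {n : ℕ}

/-! ## §1 Special abscissa ⟹ membership in `φ_n(A_n(ℚ)) + E_n[2]`; the generator-free reading of `ρ(n) ≠ 0` -/

/-- `E_n` has the rational `2`-torsion `0, −n, n` (in this order). [folklore] -/
private theorem hsplit (n : ℕ) : (congruentNumberCurve n).toAffine.SplitTwoTorsion 0 (-(n : ℚ)) n :=
  (splitTwoTorsion_cn n).swap₁₂

/-- `[g·t²] = [g]` in `ℚ^×/ℚ^{×2}`. [folklore] -/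
private theorem sqClass_mul_sq {g t : ℚ} (hg : g ≠ 0) (ht : t ≠ 0) : sqClass (g * t ^ 2) = sqClass g := by
  rw [sqClass_mul hg (pow_ne_zero 2 ht), sqClass_sq, SqUnits.mul_one]

/-- **A rational point of `E_n` with abscissa in `{1, −1, n, −n}·ℚ^{×2}` lies in `φ_n(A_n(ℚ)) + E_n[2]`** (`n ≠ 0`): translate by the
`2`-torsion point with the same `x`-class (`(0,0) ↦ [−1]`, `(n,0) ↦ [n]`, `(−n,0) ↦ [−n]`) and use that a point of trivial class is in
`φ_n(A_n(ℚ)) ∪ {O}` (`RhoMonskyKernel.mem_rhoSubgroup_of_sqClass_eq_one`). [cite: SilvermanAEC2009, Prop. X.4.9]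
[cite: TianYuanZhang2017, §1, definition of ρ(n) (p0002 L101–L110)] -/
theorem mem_rhoSubgroup_of_x_special (hn : n ≠ 0) {x y : ℚ} (hxy : (congruentNumberCurve n).toAffine.Nonsingular x y)
    (hx : ∃ q : ℚ, x = q ^ 2 ∨ x = -q ^ 2 ∨ x = n * q ^ 2 ∨ x = -(n * q ^ 2)) :
    (Point.some x y hxy : (congruentNumberCurve n).toAffine.Point) ∈ rhoSubgroup n := by
  haveI := isElliptic_congruentNumberCurve hn
  have h0 := hsplit n
  -- the case `x = 0`: `R` is the `2`-torsion point `(0,0)`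
  by_cases hx0 : x = 0
  · subst hx0
    obtain rfl := eq_twoTorsionY_of_eq h0 hxy
    exact AddSubgroup.subset_closure (Or.inr (two_nsmul_twoTorsion h0))
  set N : ℚ := (n : ℚ) with hN
  have hN0 : N ≠ 0 := by rw [hN]; exact_mod_cast hn
  set R : (congruentNumberCurve n).toAffine.Point := Point.some x y hxy with hRdef
  -- `x ≠ 0`: the class of `R` is `[x]`
  have hcR : twoDescentComponent _ 0 (-N) N R = sqClass x := by
    rw [hRdef, twoDescentComponent_some_of_ne _ hx0, sub_zero]
  obtain ⟨q, hq⟩ := hx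
  have hq0 : q ≠ 0 := by
    rintro rfl
    rcases hq with h | h | h | h <;> simp [h] at hx0
  -- the three `2`-torsion points and their classes
  set T0 : (congruentNumberCurve n).toAffine.Point := .some 0 _ (nonsingular_twoTorsion h0) with hT0
  set Tm : (congruentNumberCurve n).toAffine.Point := .some _ _ (nonsingular_twoTorsion h0.swap₁₂) with hTm
  set Tp : (congruentNumberCurve n).toAffine.Point := .some _ _ (nonsingular_twoTorsion h0.swap₂₃.swap₁₂) with hTp
  have mT0 : T0 ∈ rhoSubgroup n := AddSubgroup.subset_closure (Or.inr (two_nsmul_twoTorsion h0))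
  have mTm : Tm ∈ rhoSubgroup n := AddSubgroup.subset_closure (Or.inr (two_nsmul_twoTorsion h0.swap₁₂))
  have mTp : Tp ∈ rhoSubgroup n := AddSubgroup.subset_closure (Or.inr (two_nsmul_twoTorsion h0.swap₂₃.swap₁₂))
  have cT0 : twoDescentComponent _ 0 (-N) N T0 = sqClass (-1 : ℚ) := by
    rw [hT0, twoDescentComponent_some_of_eq _ rfl, show ((0:ℚ) - -N) * (0 - N) = (-1) * N ^ 2 by ring,
      sqClass_mul_sq (by norm_num) hN0]
  have cTm : twoDescentComponent _ 0 (-N) N Tm = sqClass (-N) := by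
    rw [hTm, twoDescentComponent_some_of_ne _ (neg_ne_zero.mpr hN0), sub_zero]
  have cTp : twoDescentComponent _ 0 (-N) N Tp = sqClass N := by
    rw [hTp, twoDescentComponent_some_of_ne _ hN0, sub_zero]
  -- translating by a torsion point of the same class gives a point of trivial class
  have step : ∀ T : (congruentNumberCurve n).toAffine.Point, T ∈ rhoSubgroup n →
      twoDescentComponent _ 0 (-N) N T = twoDescentComponent _ 0 (-N) N R → R ∈ rhoSubgroup n := by
    intro T hT hc
    have h1 : sqClass (descentRep 0 (-N) N (R + T)) = 1 := by
      rw [← twoDescentComponent_eq_sqClass, twoDescentComponent_add h0, hc, SqUnits.mul_self]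
    have hRT := mem_rhoSubgroup_of_sqClass_eq_one hn (R + T) h1
    have := (rhoSubgroup n).sub_mem hRT hT
    rwa [add_sub_cancel_right] at this
  rcases hq with h | h | h | h
  · -- `x = q²`: trivial class
    refine mem_rhoSubgroup_of_sqClass_eq_one hn R ?_
    rw [hRdef, descentRep_some_of_ne hxy hx0, sub_zero, sqClass_eq_one_iff hx0]
    exact ⟨q, h⟩
  · exact step T0 mT0 (by rw [cT0, hcR, h, show -q ^ 2 = (-1 : ℚ) * q ^ 2 by ring, sqClass_mul_sq (by norm_num) hq0])
  · exact step Tp mTp (by rw [cTp, hcR, h, sqClass_mul_sq hN0 hq0])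
  · exact step Tm mTm (by rw [cTm, hcR, h, show -(N * q ^ 2) = -N * q ^ 2 by ring, sqClass_mul_sq (neg_ne_zero.mpr hN0) hq0])

/-- **A special generator forces `ρ(n) = 0`.**  For square-free `n`: if `R = (x, y)` generates `E_n(ℚ)` modulo torsion and
`x ∈ {1, −1, n, −n}·ℚ^{×2}`, then `φ_n(A_n(ℚ)) + E_n[2] = E_n(ℚ)` — every point is `k•R + t` with `t` torsion, `R ∈ φ_n(A_n(ℚ)) + E_n[2]` by
`mem_rhoSubgroup_of_x_special`, and `2t = 0` (Knapp, Thm. 5.2: `E_n(ℚ)_tors = E_n[2]`). [cite: TianYuanZhang2017, §1, definition of ρ(n)]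
[cite: Knapp1993, Ch. V, Thm. 5.2] -/
theorem rhoIndex_eq_one_of_generator_special (hsq : Squarefree n) {x y : ℚ}
    (hxy : (congruentNumberCurve n).toAffine.Nonsingular x y)
    (hR : haveI := isElliptic_congruentNumberCurve hsq.ne_zero;
      ∀ P, ∃ m : ℤ, IsOfFinAddOrder (P - m • (Point.some x y hxy : (congruentNumberCurve n).toAffine.Point)))
    (hx : ∃ q : ℚ, x = q ^ 2 ∨ x = -q ^ 2 ∨ x = n * q ^ 2 ∨ x = -(n * q ^ 2)) :
    (rhoSubgroup n).index = 1 := by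
  haveI := isElliptic_congruentNumberCurve hsq.ne_zero
  rw [AddSubgroup.index_eq_one, eq_top_iff]
  intro P _
  obtain ⟨m, hm⟩ := hR P
  have hmem : (Point.some x y hxy : (congruentNumberCurve n).toAffine.Point) ∈ rhoSubgroup n :=
    mem_rhoSubgroup_of_x_special hsq.ne_zero hxy hx
  have ht : P - m • (Point.some x y hxy : (congruentNumberCurve n).toAffine.Point) ∈ rhoSubgroup n :=
    AddSubgroup.subset_closure (Or.inr (two_nsmul_eq_zero_of_isOfFinAddOrder_congruentNumberCurve hsq hm))
  have := (rhoSubgroup n).add_mem ht ((rhoSubgroup n).zsmul_mem hmem m)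
  rwa [sub_add_cancel] at this

/-- **`ρ(n) ≠ 0` ⟹ a NON-special generator exists** (square-free `n`, `rank E_n(ℚ) ≤ 1`): `E_n(ℚ)` is cyclic modulo torsion (Mordell–Weil,
`W2.stub_S0`); the generator is not `O` (else every point is torsion, killed by `2`, and `ρ(n) = 0`), and its abscissa is not special by
`rhoIndex_eq_one_of_generator_special`. [cite: TianYuanZhang2017, §1 (p0002 L101–L110) and §3.1 (p0011 L27–L36)] [cite: Knapp1993, Ch. V, Thm. 5.2] -/
theorem exists_generator_not_special_of_rhoIndex_ne_one (hsq : Squarefree n)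
    (hr : haveI := isElliptic_congruentNumberCurve hsq.ne_zero; (congruentNumberCurve n).mordellWeilRank ≤ 1)
    (hρ : (rhoSubgroup n).index ≠ 1) :
    haveI := isElliptic_congruentNumberCurve hsq.ne_zero
    ∃ (x y : ℚ) (hxy : (congruentNumberCurve n).toAffine.Nonsingular x y),
      (∀ P, ∃ m : ℤ, IsOfFinAddOrder (P - m • (Point.some x y hxy : (congruentNumberCurve n).toAffine.Point))) ∧
      ¬ ∃ q : ℚ, x = q ^ 2 ∨ x = -q ^ 2 ∨ x = n * q ^ 2 ∨ x = -(n * q ^ 2) := by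
  haveI := isElliptic_congruentNumberCurve hsq.ne_zero
  obtain ⟨R, hR⟩ := W2.stub_S0 (n := n) hr
  rcases R with _ | ⟨x, y, hxy⟩
  · -- generator `O`: every point is torsion, so `ρ(n) = 0`
    exfalso; apply hρ
    rw [AddSubgroup.index_eq_one, eq_top_iff]
    intro P _
    obtain ⟨m, hm⟩ := hR P
    rw [← WeierstrassCurve.Affine.Point.zero_def, zsmul_zero, sub_zero] at hm
    exact AddSubgroup.subset_closure (Or.inr (two_nsmul_eq_zero_of_isOfFinAddOrder_congruentNumberCurve hsq hm))
  · exact ⟨x, y, hxy, hR, fun hx => hρ (rhoIndex_eq_one_of_generator_special hsq hxy hR hx)⟩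

/-! ## §2 The lower half of C⁺ on `{ρ(n) ≠ 0}`, generator-free, from the named facts -/

/-- **THE LOWER HALF ON `{ρ(n) ≠ 0}` FROM THE NAMED FACTS, generator-free.**  Granted TYZ 2017 §3 as printed with the Frobenius package
(`tyz_cmPointRingClassFrobeniusData`), TYZ Thm 1.1 (`thm11_parity_of_scriptL`) and GZK (`rank_eq_analyticRank_of_analyticRank_le_one`): for every
square-free odd `n ≡ 5, 7 (mod 8)` with `ord_{s=1} L(E_n, s) = 1`, `#Sel₂(E_n/ℚ) = 2^{2+s}` with `s ≥ 2`, and `ρ(n) ≠ 0`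
(`[E_n(ℚ) : φ_n(A_n(ℚ)) + E_n[2]] ≠ 1`), `2 ∣ L` whenever `𝓛(n)² = L²`.
[cite: TianYuanZhang2017, Thm. 1.1, §1 (ρ(n)) and §3] [cite: HeathBrown1994SelmerCongruentII, Appendix (Monsky)] [cite: Darmon2004, Thm. 3.22] -/
theorem two_dvd_scriptL_odd_of_rhoIndex_ne_one_of_facts' (hF : tyz_cmPointRingClassFrobeniusData) (h11 : thm11_parity_of_scriptL)
    (hGZK : rank_eq_analyticRank_of_analyticRank_le_one)
    (hsq : Squarefree n) (h57 : n % 8 = 5 ∨ n % 8 = 7)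
    (hr : haveI := isElliptic_congruentNumberCurve hsq.ne_zero; (congruentNumberCurve n).analyticRank = 1)
    {s : ℕ} (hs : 2 ≤ s)
    (hsel : haveI := isElliptic_congruentNumberCurve hsq.ne_zero; Nat.card ((congruentNumberCurve n).selmerGroup 2) = 2 ^ (2 + s))
    (hρ : (rhoSubgroup n).index ≠ 1) :
    ∀ L : ℤ, IsScriptL n L → (2 : ℤ) ∣ L := by
  haveI := isElliptic_congruentNumberCurve hsq.ne_zero
  have hrk : (congruentNumberCurve n).mordellWeilRank ≤ 1 := by
    have h := (hGZK (congruentNumberCurve n) (by rw [hr])).1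
    rw [h, hr]
  obtain ⟨x, y, hxy, hR, hx⟩ := exists_generator_not_special_of_rhoIndex_ne_one hsq hrk hρ
  exact LowerHalfRhoOne.two_dvd_scriptL_rhoOne_odd_of_facts' hF h11 hGZK hsq h57 hr hs hsel hxy hR hx

/-- **`OfFacts` shape for the planner** (generator-free twin of aside 23304): the three named facts imply the lower half of C⁺ on the stratum
`ρ(n) ≠ 0` of the odd `s ≥ 2` class. [cite: TianYuanZhang2017, Thm. 1.1, §1 (ρ(n)) and §3] [cite: HeathBrown1994SelmerCongruentII, Appendix (Monsky)] -/
theorem two_dvd_scriptL_odd_of_rhoIndex_ne_one_of_facts :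
    (tyz_cmPointRingClassFrobeniusData ∧ thm11_parity_of_scriptL ∧ rank_eq_analyticRank_of_analyticRank_le_one) →
      ∀ n : ℕ, (hsq : Squarefree n) → (n % 8 = 5 ∨ n % 8 = 7) →
        (haveI := isElliptic_congruentNumberCurve hsq.ne_zero; (congruentNumberCurve n).analyticRank = 1) →
        ∀ s : ℕ, 2 ≤ s →
          (haveI := isElliptic_congruentNumberCurve hsq.ne_zero; Nat.card ((congruentNumberCurve n).selmerGroup 2) = 2 ^ (2 + s)) →
          (rhoSubgroup n).index ≠ 1 → ∀ L : ℤ, IsScriptL n L → (2 : ℤ) ∣ L :=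
  fun h _ hsq h57 hr _ hs hsel hρ => two_dvd_scriptL_odd_of_rhoIndex_ne_one_of_facts' h.1 h.2.1 h.2.2 hsq h57 hr hs hsel hρ

/-! ## §3 The special stratum `ρ(n) = 0` is the exact residual of the odd lower half -/

/-- **REDUCTION: the odd lower half of C⁺ on the whole `s ≥ 2` class follows from the same statement on the special stratum `ρ(n) = 0`**
(granted the three named facts; pure logic with §2).  The hypothesis `hZero` is the OPEN research statement «lower half on `{ρ = 0}`» (crux
workfile `Lines/offtyz_v7_SpecialStratum.md` §6); nothing is asserted about it here. [cite: TianYuanZhang2017, Thm. 1.1, §1 (ρ(n)) and §3] -/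
theorem two_dvd_scriptL_odd_of_rhoZero_statement
    (hF : tyz_cmPointRingClassFrobeniusData ∧ thm11_parity_of_scriptL ∧ rank_eq_analyticRank_of_analyticRank_le_one)
    (hZero : ∀ n : ℕ, (hsq : Squarefree n) → (n % 8 = 5 ∨ n % 8 = 7) →
        (haveI := isElliptic_congruentNumberCurve hsq.ne_zero; (congruentNumberCurve n).analyticRank = 1) →
        ∀ s : ℕ, 2 ≤ s →
          (haveI := isElliptic_congruentNumberCurve hsq.ne_zero; Nat.card ((congruentNumberCurve n).selmerGroup 2) = 2 ^ (2 + s)) →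
          (rhoSubgroup n).index = 1 → ∀ L : ℤ, IsScriptL n L → (2 : ℤ) ∣ L)
    (hsq : Squarefree n) (h57 : n % 8 = 5 ∨ n % 8 = 7)
    (hr : haveI := isElliptic_congruentNumberCurve hsq.ne_zero; (congruentNumberCurve n).analyticRank = 1)
    {s : ℕ} (hs : 2 ≤ s)
    (hsel : haveI := isElliptic_congruentNumberCurve hsq.ne_zero; Nat.card ((congruentNumberCurve n).selmerGroup 2) = 2 ^ (2 + s)) :
    ∀ L : ℤ, IsScriptL n L → (2 : ℤ) ∣ L := by
  by_cases hρ : (rhoSubgroup n).index = 1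
  · exact hZero n hsq h57 hr s hs hsel hρ
  · exact two_dvd_scriptL_odd_of_rhoIndex_ne_one_of_facts hF n hsq h57 hr s hs hsel hρ

/-! ## §4 (appended, LEAD cycle 16) Witness-point form: ONE rational point with non-special abscissa suffices -/

/-- **A rational point with abscissa outside `{1, −1, n, −n}·ℚ^{×2}` forces `ρ(n) ≠ 0`** (`n ≠ 0`; the tree's `rhoIndex_ne_one_of_witness` read
in the `∃ q, x = ±q², ±n q²` currency of the lineage's lower-half theorems): if `[x₀] = [c]` for `c ∈ {1, −1, n, −n}` then `x₀ c = u²` and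
`x₀ = c·(u/c)²`. [cite: TianYuanZhang2017, §1, definition of ρ(n)] [cite: SilvermanAEC2009, Prop. X.4.9] -/
theorem rhoIndex_ne_one_of_point (hn : n ≠ 0) {x₀ y₀ : ℚ} (h₀ : (congruentNumberCurve n).toAffine.Nonsingular x₀ y₀)
    (hx₀ : ¬ ∃ q : ℚ, x₀ = q ^ 2 ∨ x₀ = -q ^ 2 ∨ x₀ = n * q ^ 2 ∨ x₀ = -(n * q ^ 2)) :
    (rhoSubgroup n).index ≠ 1 := by
  haveI := isElliptic_congruentNumberCurve hn
  have hN0 : (n : ℚ) ≠ 0 := by exact_mod_cast hn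
  have hx0 : x₀ ≠ 0 := by rintro rfl; exact hx₀ ⟨0, Or.inl (by ring)⟩
  refine rhoIndex_ne_one_of_witness hn (Point.some x₀ y₀ h₀) ?_
  rw [descentRep_some_of_ne h₀ hx0, sub_zero]
  -- `[x₀] = [c]` with `c ≠ 0` gives `x₀ = c · (u/c)²`
  have key : ∀ c : ℚ, c ≠ 0 → sqClass x₀ = sqClass c → ∃ q : ℚ, x₀ = c * q ^ 2 := by
    intro c hc h
    have h1 : sqClass (x₀ * c) = 1 := by rw [sqClass_mul hx0 hc, h, SqUnits.mul_self]
    obtain ⟨u, hu⟩ := (sqClass_eq_one_iff (mul_ne_zero hx0 hc)).mp h1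
    refine ⟨u / c, ?_⟩
    rw [div_pow, ← mul_div_assoc, eq_div_iff (pow_ne_zero 2 hc)]
    linear_combination c * hu
  have one_eq : (1 : SqUnits ℚ) = sqClass (1 : ℚ) := by rw [← mul_one (1 : ℚ), sqClass_mul_self]
  rintro (h | h | h | h)
  · obtain ⟨q, hq⟩ := key 1 one_ne_zero (by rw [h, one_eq])
    exact hx₀ ⟨q, Or.inl (by rw [hq]; ring)⟩
  · obtain ⟨q, hq⟩ := key (-1) (by norm_num) h
    exact hx₀ ⟨q, Or.inr (Or.inl (by rw [hq]; ring))⟩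
  · obtain ⟨q, hq⟩ := key n hN0 h
    exact hx₀ ⟨q, Or.inr (Or.inr (Or.inl hq))⟩
  · obtain ⟨q, hq⟩ := key (-(n : ℚ)) (neg_ne_zero.mpr hN0) h
    exact hx₀ ⟨q, Or.inr (Or.inr (Or.inr (by rw [hq]; ring)))⟩

/-- **THE LOWER HALF FROM ONE WITNESS POINT.**  Granted `tyz_cmPointRingClassFrobeniusData ∧ thm11_parity_of_scriptL ∧ GZK`: for square-free odd
`n ≡ 5, 7 (mod 8)` with `ord_{s=1} L(E_n, s) = 1`, `#Sel₂(E_n/ℚ) = 2^{2+s}` (`s ≥ 2`), and ANY rational point `(x₀, y₀) ∈ E_n(ℚ)` with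
`x₀ ∉ {1, −1, n, −n}·ℚ^{×2}` (no generator, no Mordell–Weil basis needed — e.g. `(245, 2100) ∈ E_205(ℚ)`, `x₀ = 5·7²`), every integer `L` with
`𝓛(n)² = L²` is even. [cite: TianYuanZhang2017, Thm. 1.1, §1 (ρ(n)) and §3] [cite: HeathBrown1994SelmerCongruentII, Appendix (Monsky)] -/
theorem two_dvd_scriptL_odd_of_point_of_facts
    (hF : tyz_cmPointRingClassFrobeniusData ∧ thm11_parity_of_scriptL ∧ rank_eq_analyticRank_of_analyticRank_le_one)
    (hsq : Squarefree n) (h57 : n % 8 = 5 ∨ n % 8 = 7)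
    (hr : haveI := isElliptic_congruentNumberCurve hsq.ne_zero; (congruentNumberCurve n).analyticRank = 1)
    {s : ℕ} (hs : 2 ≤ s)
    (hsel : haveI := isElliptic_congruentNumberCurve hsq.ne_zero; Nat.card ((congruentNumberCurve n).selmerGroup 2) = 2 ^ (2 + s))
    {x₀ y₀ : ℚ} (h₀ : (congruentNumberCurve n).toAffine.Nonsingular x₀ y₀)
    (hx₀ : ¬ ∃ q : ℚ, x₀ = q ^ 2 ∨ x₀ = -q ^ 2 ∨ x₀ = n * q ^ 2 ∨ x₀ = -(n * q ^ 2)) :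
    ∀ L : ℤ, IsScriptL n L → (2 : ℤ) ∣ L :=
  two_dvd_scriptL_odd_of_rhoIndex_ne_one_of_facts hF n hsq h57 hr s hs hsel (rhoIndex_ne_one_of_point hsq.ne_zero h₀ hx₀)

end Summit.BirchSwinnertonDyer.PrintCf2.SpecialStratum

end
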